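import Literature.NumberTheory.Sieve.MoebiusCharacterMeanValue
import Literature.NumberTheory.Sieve.Polymath8aMoebiusSiegelWalfisz
import Literature.NumberTheory.LFunctions.SiegelWalfiszMoebiusProofs
import HarnessLib

/-!
# The Bombieri–Vinogradov theorem for the Möbius function

Topic `Literature/NumberTheory/Sieve`; everything in this file is PROVED (theorems, plus plain
definitions with bodies).  Main result (`Literature.NumberTheory.Sieve.bombieriVinogradov_moebius`):
for every `A > 0` there are `B > 0`, `C ≥ 0`, `x₀` such that for `x ≥ x₀`, `Q ≤ x^{1/2}(log x)^{-B}`,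
arbitrary integer cut-offs `N_q ≤ x` and reduced residues `a_q (mod q)`,

  `∑_{q ≤ Q} |∑_{n ≤ N_q, n ≡ a_q (q)} μ(n) − φ(q)⁻¹ ∑_{n ≤ N_q, (n, q) = 1} μ(n)| ≤ C x (log x)^{-A}`.

This is the case `f = μ ∈ 𝓕(1, 1)`, `D = 1` of É. Fouvry, G. Tenenbaum, *Multiplicative functions in
large arithmetic progressions and applications*, Trans. Amer. Math. Soc. 375 (2022), Theorem 1.8
[FouvryTenenbaum2021] (a classical statement: a special case of Iwaniec–Kowalski, Theorem 17.4, or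
of Wolke, Math. Ann. 202 (1973), Satz 1), and the input of the Liouville case
(`FouvryTenenbaumLiouvilleProofs.lean`, through `λ = 𝟙_□ ⋆ μ`).  The printed proof of Theorem 1.8
(FT §8, PDF p. 35) is a twelve-line sketch resting on the paper's combinatorial preparation
(§5, factorisation (5.8)), its Lemma 4.15 and [21, Theorem 8.4]; for the special case needed here we
follow instead the classical route already used by the tree for `Λ`
(`BombieriVinogradovReduction.lean`: Vaughan, Acta Arith. 37 (1980), Theorem 3; Davenport,
*Multiplicative Number Theory*, ch. 28; Cojocaru–Murty §9.2), with two genuine differences: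

* the principal character contributes exactly the subtracted mean `φ(q)⁻¹ ∑_{(n,q)=1} μ(n)`, so no
  main term appears (`abs_moebiusDisc_le`, orthogonality);
* a character `mod q` induced by the primitive `χ₁ mod d` is `n ↦ χ₁(n)𝟙[(n, q/d) = 1]`
  (`changeLevel_apply_natCast`), and for `μ` (unlike `Λ`) the condition `(n, q/d) = 1` cannot be
  removed trivially: it is carried through the mean value theorem
  (`Literature.NumberTheory.Sieve.moebius_character_meanValue`, files `MoebiusCharacterSums.lean`,
  `MoebiusCharacterMeanValue.lean`) and through the Siegel–Walfisz input, which is the tree's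
  `Literature.NumberTheory.Sieve.Polymath8a.sum_moebius_coprime_progression_le_uniform` fed with
  `Literature.NumberTheory.LFunctions.SiegelWalfiszMoebius_holds`; the extra sum over `r = q/d`
  costs the divisor sums `∑_{r ≤ Q} 4^{ω(r)}/φ(r) ≤ (1 + log Q)⁸`, `∑_{r ≤ Q} τ(r)/φ(r) ≤ (1 + log Q)⁴`.

## Contents

* `moebiusAPSum`, `moebiusCoprimeSum`, `moebiusDisc` (`Δ_μ(N; q, a)`), `charSum`, `charSum'`;
  Step A `abs_moebiusDisc_le` (orthogonality, Mathlib's `DirichletCharacter.sum_char_inv_mul_char_eq`).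
* Step B `changeLevel_apply_natCast`, `charSum_changeLevel`, `norm_charSum'_induce_le` (through the
  tree's index set `Literature.NumberTheory.Sieve.primIndex` / `induce`).
* `Msup` (`max_{N ≤ x} |M_r(N, χ)|`), `mvTerm`, `sum_mvTerm_le` (the mean value theorem in summed
  form), `abs_moebiusDisc_le_sum_primIndex`, Step C `sum_totient_inv_mul_sum_primIndex_le`
  (swapping the sums over the hyperbola `dr ≤ Q`, `sum_Ioc_sum_Ioc_div_comm`).
* Step D `moebiusCharSum_eq_sum_units`, `Msup_le_of_forall`, `totient_inv_mul_sum_Msup_le` (small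
  conductors); Step E `sum_Ioc_mvTerm_div_le` (large conductors, Abel summation
  `Literature.NumberTheory.Sieve.sum_Ioc_div_le_abel`); the divisor sums
  `sum_card_divisors_cube_div_le`, `sum_card_divisors_div_totient_le`, `sum_four_pow_div_totient_le`.
* `sum_abs_moebiusDisc_le_of_bounds` (the bound under the eventual side conditions, `B = A + 8`)
  and `Literature.NumberTheory.Sieve.bombieriVinogradov_moebius`; `sqResidue`, `isUnit_sqResidue`
  (the residue selector `a s̄` used by `FouvryTenenbaumLiouvilleProofs.lean`).

## References

* É. Fouvry, G. Tenenbaum, Trans. Amer. Math. Soc. 375 (2022), 245–299, Theorem 1.8 and §8.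
  [FouvryTenenbaum2021]
* R. C. Vaughan, Acta Arith. 37 (1980), 111–115, Theorem 3. [Vaughan1980]
* H. Iwaniec, E. Kowalski, *Analytic Number Theory*, AMS 2004, Theorem 17.4. [IwaniecKowalski2004]
* A. C. Cojocaru, M. R. Murty, *An Introduction to Sieve Methods and their Applications*, CUP 2005,
  §9.2. [CojocaruMurty2005]
-/

namespace Literature.NumberTheory.Sieve

namespace BVMoebius

open Finset Real Complex ArithmeticFunction Vaughan VaughanMoebius
open scoped ArithmeticFunction.Moebius ArithmeticFunction.sigma Classical

/-! ### The discrepancy of `μ` in a reduced residue class and orthogonality -/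

/-- `∑_{n ≤ N, n ≡ a (q)} μ(n)`. [folklore] -/
noncomputable def moebiusAPSum (N q : ℕ) (a : ZMod q) : ℝ :=
  ∑ n ∈ (Icc 1 N).filter (fun n : ℕ => (n : ZMod q) = a), (μ n : ℝ)

/-- `∑_{n ≤ N, (n, q) = 1} μ(n)`. [folklore] -/
noncomputable def moebiusCoprimeSum (N q : ℕ) : ℝ :=
  ∑ n ∈ (Icc 1 N).filter (fun n : ℕ => n.Coprime q), (μ n : ℝ)

/-- The discrepancy `Δ_μ(N; q, a) = ∑_{n ≤ N, n ≡ a (q)} μ(n) − φ(q)⁻¹ ∑_{n ≤ N, (n,q)=1} μ(n)`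
(Fouvry–Tenenbaum (1.1) for `f = μ` at an integer). [cite: FouvryTenenbaum2021, (1.1)] -/
noncomputable def moebiusDisc (N q : ℕ) (a : ZMod q) : ℝ :=
  moebiusAPSum N q a - ((Nat.totient q : ℝ))⁻¹ * moebiusCoprimeSum N q

/-- `M(N, χ) = ∑_{n ≤ N} μ(n) χ(n)` for a character `χ mod q` (not necessarily primitive).
[folklore] -/
noncomputable def charSum {q : ℕ} (χ : DirichletCharacter ℂ q) (N : ℕ) : ℂ :=
  ∑ n ∈ Icc 1 N, (μ n : ℂ) * χ n

/-- `M'(N, χ) = M(N, χ)` for `χ ≠ χ₀` and `0` for the principal character. [folklore] -/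
noncomputable def charSum' {q : ℕ} (χ : DirichletCharacter ℂ q) (N : ℕ) : ℂ :=
  if χ = 1 then 0 else charSum χ N

/-- `M(N, χ₀) = ∑_{n ≤ N, (n,q)=1} μ(n)`. [folklore] -/
theorem charSum_one (q : ℕ) [NeZero q] (N : ℕ) :
    charSum (1 : DirichletCharacter ℂ q) N = (moebiusCoprimeSum N q : ℂ) := by
  rw [charSum, moebiusCoprimeSum, Complex.ofReal_sum, sum_filter]
  refine sum_congr rfl fun n _ => ?_
  by_cases h : n.Coprime q
  · rw [MulChar.one_apply ((ZMod.isUnit_iff_coprime n q).2 h), if_pos h]; push_cast; ring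
  · rw [MulChar.map_nonunit _ (fun h' => h ((ZMod.isUnit_iff_coprime n q).1 h')), if_neg h]; simp

/-- **Orthogonality**: for `(a, q) = 1`,
`∑_{n ≤ N, n ≡ a (q)} μ(n) = φ(q)⁻¹ ∑_{χ mod q} χ(a⁻¹) M(N, χ)`. [folklore] -/
theorem moebiusAPSum_eq (q : ℕ) [NeZero q] {a : ZMod q} (ha : IsUnit a) (N : ℕ) :
    (moebiusAPSum N q a : ℂ) =
      ((Nat.totient q : ℂ))⁻¹ * ∑ χ : DirichletCharacter ℂ q, χ a⁻¹ * charSum χ N := by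
  have hφ : (Nat.totient q : ℂ) ≠ 0 := by exact_mod_cast (Nat.totient_pos.2 (NeZero.pos q)).ne'
  have key : ∀ n : ℕ, ∑ χ : DirichletCharacter ℂ q, χ a⁻¹ * χ n =
      if (n : ZMod q) = a then (Nat.totient q : ℂ) else 0 := by
    intro n
    rw [DirichletCharacter.sum_char_inv_mul_char_eq ℂ ha]
    by_cases h : (n : ZMod q) = a
    · rw [if_pos h.symm, if_pos h]
    · rw [if_neg (Ne.symm h), if_neg h]
  calc (moebiusAPSum N q a : ℂ)
      = ∑ n ∈ Icc 1 N, if (n : ZMod q) = a then (μ n : ℂ) else 0 := by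
        rw [moebiusAPSum, Complex.ofReal_sum, sum_filter]
        refine sum_congr rfl fun n _ => ?_
        split_ifs <;> simp
    _ = ∑ n ∈ Icc 1 N, ((Nat.totient q : ℂ))⁻¹ * ((μ n : ℂ) * ∑ χ : DirichletCharacter ℂ q,
          χ a⁻¹ * χ n) := by
        refine sum_congr rfl fun n _ => ?_
        rw [key]
        split_ifs
        · field_simp
        · simp
    _ = _ := by
        rw [← mul_sum]
        congr 1
        simp only [charSum, mul_sum]
        rw [sum_comm]
        exact sum_congr rfl fun χ _ => sum_congr rfl fun n _ => by ring

/-- **Step A** (orthogonality): for `(a, q) = 1`,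
`|Δ_μ(N; q, a)| ≤ φ(q)⁻¹ ∑_{χ mod q} |M'(N, χ)|`. [folklore] -/
theorem abs_moebiusDisc_le (q : ℕ) [NeZero q] {a : ZMod q} (ha : IsUnit a) (N : ℕ) :
    |moebiusDisc N q a| ≤
      ((Nat.totient q : ℝ))⁻¹ * ∑ χ : DirichletCharacter ℂ q, ‖charSum' χ N‖ := by
  classical
  have hφpos : 0 < (Nat.totient q : ℝ) := by exact_mod_cast Nat.totient_pos.mpr (NeZero.pos q)
  have ha' : IsUnit a⁻¹ := by
    obtain ⟨u, rfl⟩ := ha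
    rw [ZMod.inv_coe_unit]; exact (u⁻¹).isUnit
  have h3 : ∑ χ : DirichletCharacter ℂ q, χ a⁻¹ * (charSum' χ N - charSum χ N) =
      -(moebiusCoprimeSum N q : ℂ) := by
    rw [Finset.sum_eq_single (1 : DirichletCharacter ℂ q)]
    · rw [charSum', if_pos rfl, charSum_one, MulChar.one_apply ha']; ring
    · intro χ _ hχ; rw [charSum', if_neg hχ]; ring
    · simp
  have key : ((moebiusDisc N q a : ℝ) : ℂ) =
      ((Nat.totient q : ℂ))⁻¹ * ∑ χ : DirichletCharacter ℂ q, χ a⁻¹ * charSum' χ N := by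
    have h4 : ∑ χ : DirichletCharacter ℂ q, χ a⁻¹ * charSum' χ N =
        ∑ χ : DirichletCharacter ℂ q, χ a⁻¹ * charSum χ N +
        ∑ χ : DirichletCharacter ℂ q, χ a⁻¹ * (charSum' χ N - charSum χ N) := by
      rw [← Finset.sum_add_distrib]
      exact Finset.sum_congr rfl fun χ _ => by ring
    rw [h4, h3, moebiusDisc, Complex.ofReal_sub, moebiusAPSum_eq q ha]
    push_cast
    ring
  rw [← Real.norm_eq_abs, ← Complex.norm_real, key, norm_mul, norm_inv, Complex.norm_natCast]
  refine mul_le_mul_of_nonneg_left ((norm_sum_le _ _).trans (Finset.sum_le_sum fun χ _ => ?_))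
    (inv_nonneg.2 hφpos.le)
  rw [norm_mul]
  exact mul_le_of_le_one_left (norm_nonneg _) (χ.norm_le_one _)

/-! ### Step B: induced characters are the coprimality-twisted characters -/

/-- For `d ∣ q`, the character mod `q` induced by `χ₁ mod d` is `χ₁` restricted to the integers
coprime to `q/d`: `(changeLevel χ₁)(n) = χ₁(n) 𝟙[(n, q/d) = 1]`. [folklore] -/
theorem changeLevel_apply_natCast {d q : ℕ} [NeZero q] (hdq : d ∣ q) (χ₁ : DirichletCharacter ℂ d)
    (n : ℕ) : DirichletCharacter.changeLevel hdq χ₁ (n : ZMod q) = copChar (q / d) χ₁ n := by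
  obtain ⟨r, hr⟩ := hdq
  have hr0 : r ≠ 0 := fun h => NeZero.ne q (by rw [hr, h, mul_zero])
  have hd0 : d ≠ 0 := fun h => NeZero.ne q (by rw [hr, h, zero_mul])
  haveI : NeZero d := ⟨hd0⟩
  have hqd : q / d = r := by rw [hr, Nat.mul_div_cancel_left r (Nat.pos_of_ne_zero hd0)]
  rw [hqd]
  unfold copChar
  by_cases hu : IsUnit (n : ZMod q)
  · have hcop : n.Coprime q := (ZMod.isUnit_iff_coprime n q).1 hu
    have hcopr : n.Coprime r := Nat.Coprime.coprime_dvd_right ⟨d, by rw [hr, mul_comm]⟩ hcop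
    rw [if_pos hcopr]
    obtain ⟨u, hu'⟩ := hu
    rw [← hu', DirichletCharacter.changeLevel_eq_cast_of_dvd χ₁ ⟨r, hr⟩ u, hu', ZMod.cast_natCast ⟨r, hr⟩]
  · rw [MulChar.map_nonunit _ hu]
    by_cases hcopr : n.Coprime r
    · rw [if_pos hcopr]
      have hnd : ¬ n.Coprime d := by
        intro hnd
        exact hu ((ZMod.isUnit_iff_coprime n q).2 (hr ▸ Nat.Coprime.mul_right hnd hcopr))
      rw [MulChar.map_nonunit _ (fun h => hnd ((ZMod.isUnit_iff_coprime n d).1 h))]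
    · rw [if_neg hcopr]

/-- `M(N, changeLevel χ₁) = M_{q/d}(N, χ₁)`. [folklore] -/
theorem charSum_changeLevel {d q : ℕ} [NeZero q] (hdq : d ∣ q) (χ₁ : DirichletCharacter ℂ d)
    (N : ℕ) : charSum (DirichletCharacter.changeLevel hdq χ₁) N = moebiusCharSum (q / d) χ₁ N := by
  rw [charSum, moebiusCharSum, Ioc_zero_eq_Icc_one]
  exact sum_congr rfl fun n _ => by rw [changeLevel_apply_natCast]

/-- For `(d, χ₁) ∈ S(q)`: `‖M'(N, induce (d, χ₁))‖ ≤ ‖M_{q/d}(N, χ₁)‖`, and `= 0` if `d = 1`.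
[folklore] -/
theorem norm_charSum'_induce_le {q : ℕ} [NeZero q] {p : Σ d : ℕ, DirichletCharacter ℂ d}
    (hp : p ∈ primIndex q) (N : ℕ) :
    ‖charSum' (induce q p) N‖ ≤ if p.1 = 1 then 0 else ‖moebiusCharSum (q / p.1) p.2 N‖ := by
  classical
  obtain ⟨d, χ₁⟩ := p
  obtain ⟨hdq, -, -⟩ := mem_primIndex.1 hp
  dsimp only at hdq ⊢
  rw [induce, dif_pos hdq]
  split_ifs with hd
  · subst hd
    rw [DirichletCharacter.level_one χ₁, DirichletCharacter.changeLevel_one, charSum', if_pos rfl,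
      norm_zero]
  · rw [charSum']
    split_ifs
    · rw [norm_zero]; exact norm_nonneg _
    · rw [charSum_changeLevel]

/-! ### The `N`-uniform majorant `M*_r(x; χ)` and the mean value theorem in summed form -/

/-- `M*_r(x; χ) = max_{N ≤ x} |M_r(N, χ)|`, realised as a `Finset.sup'` over the integers
`0 ≤ N ≤ ⌊x⌋` (no junk value: the range is nonempty). [folklore] -/
noncomputable def Msup (r : ℕ) {d : ℕ} (χ : DirichletCharacter ℂ d) (x : ℝ) : ℝ :=
  (range (⌊x⌋₊ + 1)).sup' ⟨0, by simp⟩ fun N : ℕ => ‖moebiusCharSum r χ N‖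

/-- `M*_r(x; χ) ≥ 0`. [folklore] -/
theorem Msup_nonneg (r : ℕ) {d : ℕ} (χ : DirichletCharacter ℂ d) (x : ℝ) : 0 ≤ Msup r χ x :=
  (norm_nonneg (moebiusCharSum r χ 0)).trans
    (Finset.le_sup' (fun N : ℕ => ‖moebiusCharSum r χ N‖) (by simp))

/-- `|M_r(N, χ)| ≤ M*_r(x; χ)` for `N ≤ x`. [folklore] -/
theorem norm_moebiusCharSum_le_Msup (r : ℕ) {d : ℕ} (χ : DirichletCharacter ℂ d) {N : ℕ} {x : ℝ}
    (hN : (N : ℝ) ≤ x) : ‖moebiusCharSum r χ N‖ ≤ Msup r χ x := by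
  refine Finset.le_sup' (fun N : ℕ => ‖moebiusCharSum r χ N‖) ?_
  exact mem_range.2 (Nat.lt_succ_of_le (Nat.le_floor hN))

/-- Maximising cut-offs: `M*_r(x; χ) = |M_r(X(d, χ), χ)|` for suitable integers `X(d, χ) ≤ ⌊x⌋`.
[folklore] -/
theorem exists_cutoff_Msup (r : ℕ) (x : ℝ) :
    ∃ X : (d : ℕ) → DirichletCharacter ℂ d → ℕ, (∀ d χ, X d χ ≤ ⌊x⌋₊) ∧
      ∀ d (χ : DirichletCharacter ℂ d), Msup r χ x = ‖moebiusCharSum r χ (X d χ)‖ := by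
  have hX : ∀ d (χ : DirichletCharacter ℂ d), ∃ N : ℕ, N ≤ ⌊x⌋₊ ∧
      Msup r χ x = ‖moebiusCharSum r χ N‖ := by
    intro d χ
    obtain ⟨N, hN, hEq⟩ := Finset.exists_mem_eq_sup' (s := range (⌊x⌋₊ + 1)) ⟨0, by simp⟩
      (fun N : ℕ => ‖moebiusCharSum r χ N‖)
    exact ⟨N, Nat.lt_succ_iff.1 (mem_range.1 hN), by unfold Msup; exact hEq⟩
  choose X hXle hXeq using hX
  exact ⟨X, hXle, hXeq⟩

/-- `a_r(x; d) = (d/φ(d)) ∑*_{χ mod d} M*_r(x; χ)`, the summand of the mean value theorem in summed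
form (the analogue of `Literature.NumberTheory.Sieve.vaughanTerm`). [folklore] -/
noncomputable def mvTerm (r : ℕ) (x : ℝ) (d : ℕ) : ℝ :=
  (d : ℝ) / Nat.totient d * ∑ χ ∈ (univ : Finset (DirichletCharacter ℂ d)).filter
    DirichletCharacter.IsPrimitive, Msup r χ x

/-- `a_r(x; d) ≥ 0`. [folklore] -/
theorem mvTerm_nonneg (r : ℕ) (x : ℝ) (d : ℕ) : 0 ≤ mvTerm r x d := by
  classical
  unfold mvTerm
  exact mul_nonneg (by positivity) (Finset.sum_nonneg fun χ _ => Msup_nonneg r χ x)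

/-- **The mean value theorem in summed form**: for `r ≠ 0`, `k ≥ 1`, `x ≥ 2`,
`∑_{d ≤ k} a_r(x; d) ≤ 110000 τ(r) (x + x^{5/6} k + x^{1/2} k²) log⁴(xk)`
(`Literature.NumberTheory.Sieve.moebius_character_meanValue` at maximising cut-offs). [folklore] -/
theorem sum_mvTerm_le {r : ℕ} (hr : r ≠ 0) {k : ℕ} (hk : 1 ≤ k) {x : ℝ} (hx : 2 ≤ x) :
    ∑ d ∈ Icc 1 k, mvTerm r x d ≤
      110000 * (σ 0 r : ℝ) * (x + x ^ (5 / 6 : ℝ) * k + x ^ (1 / 2 : ℝ) * (k : ℝ) ^ 2) *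
        Real.log (x * k) ^ 4 := by
  classical
  obtain ⟨X, hXle, hXeq⟩ := exists_cutoff_Msup r x
  have h := moebius_character_meanValue r hr k hk x hx X hXle
  have e : ∑ d ∈ Icc 1 k, mvTerm r x d = Tfun k (fun q χ => moebiusCharSum r χ (X q χ)) := by
    unfold mvTerm Tfun
    refine sum_congr rfl fun d _ => ?_
    congr 1
    exact sum_congr rfl fun χ _ => hXeq d χ
  rw [e]; exact h

/-! ### Steps A–B for one modulus, and the swap of the `q`- and `d`-sums (Step C) -/

/-- Steps A–B for one modulus `q`: for `(a, q) = 1` and `N ≤ x`,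
`|Δ_μ(N; q, a)| ≤ φ(q)⁻¹ ∑_{(d, χ₁) ∈ S(q), d ≠ 1} M*_{q/d}(x; χ₁)`. [folklore] -/
theorem abs_moebiusDisc_le_sum_primIndex (q : ℕ) [NeZero q] {a : ZMod q} (ha : IsUnit a) {N : ℕ}
    {x : ℝ} (hN : (N : ℝ) ≤ x) :
    |moebiusDisc N q a| ≤ ((Nat.totient q : ℝ))⁻¹ *
      ∑ p ∈ primIndex q, (if p.1 = 1 then 0 else Msup (q / p.1) p.2 x) := by
  have hφ : 0 < (Nat.totient q : ℝ) := by exact_mod_cast Nat.totient_pos.mpr (NeZero.pos q)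
  refine (abs_moebiusDisc_le q ha N).trans (mul_le_mul_of_nonneg_left ?_ (inv_nonneg.2 hφ.le))
  refine (sum_le_sum_primIndex q fun χ => norm_nonneg _).trans (Finset.sum_le_sum fun p hp => ?_)
  refine (norm_charSum'_induce_le hp N).trans ?_
  split_ifs
  · exact le_rfl
  · exact norm_moebiusCharSum_le_Msup _ _ hN

/-- The inner sum over `S(q)` as a sum over the divisors of `q`. [folklore] -/
theorem sum_primIndex_eq_sum_divisors (q : ℕ) (x : ℝ) :
    ∑ p ∈ primIndex q, (if p.1 = 1 then 0 else Msup (q / p.1) p.2 x) =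
      ∑ d ∈ q.divisors, if d = 1 then 0 else
        ∑ χ ∈ (univ : Finset (DirichletCharacter ℂ d)).filter DirichletCharacter.IsPrimitive,
          Msup (q / d) χ x := by
  classical
  rw [primIndex, Finset.sum_sigma]
  refine sum_congr rfl fun d _ => ?_
  split_ifs <;> simp

/-- Symmetry of the hyperbola: `∑_{d ≤ Q} ∑_{r ≤ Q/d} F(d, r) = ∑_{r ≤ Q} ∑_{d ≤ Q/r} F(d, r)`.
[folklore] -/
theorem sum_Ioc_sum_Ioc_div_comm {M : Type*} [AddCommMonoid M] (F : ℕ → ℕ → M) (Q : ℕ) :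
    ∑ d ∈ Ioc 0 Q, ∑ r ∈ Ioc 0 (Q / d), F d r = ∑ r ∈ Ioc 0 Q, ∑ d ∈ Ioc 0 (Q / r), F d r := by
  rw [← sum_Ioc_sum_divisorsAntidiagonal_eq, ← sum_Ioc_sum_divisorsAntidiagonal_eq (fun r d => F d r)]
  refine sum_congr rfl fun n _ => ?_
  rw [Nat.sum_divisorsAntidiagonal (fun a b => F a b), Nat.sum_divisorsAntidiagonal' (fun a b => F b a)]

/-- **Step C** (swapping the sums, `φ(dr) ≥ φ(d)φ(r)`): with
`H_r(d) = ∑*_{χ mod d} M*_r(x; χ)`,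
`∑_{q ≤ Q} φ(q)⁻¹ ∑_{(d,χ₁) ∈ S(q), d ≠ 1} M*_{q/d}(x; χ₁) ≤ ∑_{r ≤ Q} φ(r)⁻¹ ∑_{2 ≤ d ≤ Q/r} φ(d)⁻¹ H_r(d)`.
[folklore] -/
theorem sum_totient_inv_mul_sum_primIndex_le (Q : ℕ) (x : ℝ) :
    ∑ q ∈ Icc 1 Q, ((Nat.totient q : ℝ))⁻¹ *
        ∑ p ∈ primIndex q, (if p.1 = 1 then 0 else Msup (q / p.1) p.2 x) ≤
      ∑ r ∈ Icc 1 Q, ((Nat.totient r : ℝ))⁻¹ * ∑ d ∈ Icc 1 (Q / r),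
        if d = 1 then 0 else ((Nat.totient d : ℝ))⁻¹ *
          ∑ χ ∈ (univ : Finset (DirichletCharacter ℂ d)).filter DirichletCharacter.IsPrimitive,
            Msup r χ x := by
  classical
  set H : ℕ → ℕ → ℝ := fun d r => if d = 1 then 0 else
    ∑ χ ∈ (univ : Finset (DirichletCharacter ℂ d)).filter DirichletCharacter.IsPrimitive,
      Msup r χ x with hH
  have hH0 : ∀ d r, 0 ≤ H d r := by
    intro d r; simp only [hH]; split_ifs
    · exact le_rfl
    · exact Finset.sum_nonneg fun χ _ => Msup_nonneg r χ x
  -- rewrite the left side as a sum over the hyperbola `d r ≤ Q`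
  have h1 : ∀ q ∈ Icc 1 Q, ((Nat.totient q : ℝ))⁻¹ *
      ∑ p ∈ primIndex q, (if p.1 = 1 then 0 else Msup (q / p.1) p.2 x) =
        ∑ y ∈ q.divisorsAntidiagonal, ((Nat.totient (y.1 * y.2) : ℝ))⁻¹ * H y.1 y.2 := by
    intro q hq
    have hq0 : q ≠ 0 := by have := (mem_Icc.1 hq).1; omega
    rw [sum_primIndex_eq_sum_divisors, mul_sum,
      Nat.sum_divisorsAntidiagonal (fun a b => ((Nat.totient (a * b) : ℝ))⁻¹ * H a b)]
    refine sum_congr rfl fun d hd => ?_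
    have hdq : d ∣ q := Nat.dvd_of_mem_divisors hd
    rw [Nat.mul_div_cancel' hdq]
  rw [sum_congr rfl h1, ← Ioc_zero_eq_Icc_one, sum_Ioc_sum_divisorsAntidiagonal_eq
    (fun a b => ((Nat.totient (a * b) : ℝ))⁻¹ * H a b) Q, sum_Ioc_sum_Ioc_div_comm]
  refine sum_le_sum fun r hr => ?_
  have hr1 : 1 ≤ r := (mem_Ioc.1 hr).1
  rw [mul_sum, Ioc_zero_eq_Icc_one]
  refine sum_le_sum fun d hd => ?_
  have hd1 : 1 ≤ d := (mem_Icc.1 hd).1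
  have hφ : 0 < (Nat.totient d : ℝ) * Nat.totient r := by
    have := Nat.totient_pos.2 hd1; have := Nat.totient_pos.2 hr1; positivity
  have hle : ((Nat.totient (d * r) : ℝ))⁻¹ ≤ ((Nat.totient r : ℝ))⁻¹ * ((Nat.totient d : ℝ))⁻¹ := by
    rw [← mul_inv, mul_comm ((Nat.totient r : ℝ))]
    exact inv_anti₀ hφ (by exact_mod_cast Nat.totient_super_multiplicative d r)
  simp only [hH]
  split_ifs with h
  · simp
  · calc ((Nat.totient (d * r) : ℝ))⁻¹ * ∑ χ ∈ (univ : Finset (DirichletCharacter ℂ d)).filter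
          DirichletCharacter.IsPrimitive, Msup r χ x
        ≤ ((Nat.totient r : ℝ))⁻¹ * ((Nat.totient d : ℝ))⁻¹ *
            ∑ χ ∈ (univ : Finset (DirichletCharacter ℂ d)).filter DirichletCharacter.IsPrimitive,
              Msup r χ x :=
          mul_le_mul_of_nonneg_right hle (Finset.sum_nonneg fun χ _ => Msup_nonneg r χ x)
      _ = _ := by ring

/-! ### Step D: small conductors — from characters back to residue classes -/

/-- `M_r(N, χ) = ∑_{b ∈ (ℤ/d)ˣ} χ(b) ∑_{n ≤ N, n ≡ b (d), (n,r)=1} μ(n)`. [folklore] -/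
theorem moebiusCharSum_eq_sum_units {d : ℕ} [NeZero d] (χ : DirichletCharacter ℂ d) (r N : ℕ) :
    moebiusCharSum r χ N = ∑ b : (ZMod d)ˣ, χ (b : ZMod d) *
      ((∑ n ∈ (Icc 1 N).filter (fun n : ℕ => (n : ZMod d) = b ∧ n.Coprime r), (μ n : ℝ) : ℝ) : ℂ) := by
  have key : ∀ n : ℕ, (μ n : ℂ) * copChar r χ n =
      ∑ b : (ZMod d)ˣ, if (n : ZMod d) = b ∧ n.Coprime r then χ (b : ZMod d) * (μ n : ℂ) else 0 := by
    intro n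
    unfold copChar
    by_cases hn : IsUnit (n : ZMod d)
    · rw [Finset.sum_eq_single hn.unit]
      · by_cases hc : n.Coprime r
        · rw [if_pos hc, if_pos ⟨by simp, hc⟩]; simp [mul_comm]
        · rw [if_neg hc, if_neg (fun h => hc h.2)]; simp
      · intro b _ hb
        rw [if_neg]
        rintro ⟨h, -⟩
        exact hb (Units.ext (by simp [h]))
      · simp
    · have h0 : χ (n : ZMod d) = 0 := MulChar.map_nonunit χ hn
      rw [h0]
      have : (if n.Coprime r then (0 : ℂ) else 0) = 0 := by split_ifs <;> rfl
      rw [this, mul_zero]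
      refine (Finset.sum_eq_zero fun b _ => ?_).symm
      rw [if_neg]
      rintro ⟨h, -⟩
      exact hn (h ▸ b.isUnit)
  unfold moebiusCharSum
  simp_rw [key]
  rw [Finset.sum_comm]
  refine Finset.sum_congr rfl fun b _ => ?_
  rw [Complex.ofReal_sum, Finset.mul_sum, sum_filter, Ioc_zero_eq_Icc_one]
  refine Finset.sum_congr rfl fun n _ => ?_
  split_ifs <;> simp

/-- `|M_r(N, χ)| ≤ ∑_{b ∈ (ℤ/d)ˣ} |∑_{n ≤ N, n ≡ b (d), (n,r)=1} μ(n)|`. [folklore] -/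
theorem norm_moebiusCharSum_le_sum_units {d : ℕ} [NeZero d] (χ : DirichletCharacter ℂ d) (r N : ℕ) :
    ‖moebiusCharSum r χ N‖ ≤ ∑ b : (ZMod d)ˣ,
      |∑ n ∈ (Icc 1 N).filter (fun n : ℕ => (n : ZMod d) = b ∧ n.Coprime r), (μ n : ℝ)| := by
  rw [moebiusCharSum_eq_sum_units]
  refine (norm_sum_le _ _).trans (Finset.sum_le_sum fun b _ => ?_)
  rw [norm_mul, Complex.norm_real, Real.norm_eq_abs]
  exact mul_le_of_le_one_left (abs_nonneg _) (χ.norm_le_one _)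

/-- If every `|∑_{n ≤ N, n ≡ b (d), (n,r)=1} μ(n)|` (`b` reduced, `N ≤ x`) is `≤ E`, then
`M*_r(x; χ) ≤ φ(d) E`. [folklore] -/
theorem Msup_le_of_forall {d : ℕ} [NeZero d] (χ : DirichletCharacter ℂ d) {r : ℕ} {x E : ℝ}
    (hE : ∀ b : (ZMod d)ˣ, ∀ N : ℕ, N ≤ ⌊x⌋₊ →
      |∑ n ∈ (Icc 1 N).filter (fun n : ℕ => (n : ZMod d) = b ∧ n.Coprime r), (μ n : ℝ)| ≤ E) :
    Msup r χ x ≤ Nat.totient d * E := by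
  unfold Msup
  refine Finset.sup'_le _ _ fun N hN => ?_
  have hN' : N ≤ ⌊x⌋₊ := Nat.lt_succ_iff.1 (mem_range.1 hN)
  refine (norm_moebiusCharSum_le_sum_units χ r N).trans ?_
  calc ∑ b : (ZMod d)ˣ, |∑ n ∈ (Icc 1 N).filter (fun n : ℕ => (n : ZMod d) = b ∧ n.Coprime r),
          (μ n : ℝ)| ≤ ∑ _b : (ZMod d)ˣ, E := Finset.sum_le_sum fun b _ => hE b N hN'
    _ = Nat.totient d * E := by
        rw [Finset.sum_const, Finset.card_univ, ZMod.card_units_eq_totient d, nsmul_eq_mul]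

/-- The small-conductor term: under the same hypothesis (with `E ≥ 0`),
`φ(d)⁻¹ ∑*_{χ mod d} M*_r(x; χ) ≤ d E`. [folklore] -/
theorem totient_inv_mul_sum_Msup_le {d : ℕ} (hd : 1 ≤ d) {r : ℕ} {x E : ℝ} (hE0 : 0 ≤ E)
    (hE : ∀ b : (ZMod d)ˣ, ∀ N : ℕ, N ≤ ⌊x⌋₊ →
      |∑ n ∈ (Icc 1 N).filter (fun n : ℕ => (n : ZMod d) = b ∧ n.Coprime r), (μ n : ℝ)| ≤ E) :
    ((Nat.totient d : ℝ))⁻¹ *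
        ∑ χ ∈ (univ : Finset (DirichletCharacter ℂ d)).filter DirichletCharacter.IsPrimitive,
          Msup r χ x ≤ d * E := by
  haveI : NeZero d := ⟨by omega⟩
  have hφ : (0 : ℝ) < Nat.totient d := by exact_mod_cast Nat.totient_pos.2 hd
  calc ((Nat.totient d : ℝ))⁻¹ *
        ∑ χ ∈ (univ : Finset (DirichletCharacter ℂ d)).filter DirichletCharacter.IsPrimitive,
          Msup r χ x
      ≤ ((Nat.totient d : ℝ))⁻¹ *
        ∑ _χ ∈ (univ : Finset (DirichletCharacter ℂ d)).filter DirichletCharacter.IsPrimitive,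
          (Nat.totient d * E) :=
        mul_le_mul_of_nonneg_left (Finset.sum_le_sum fun χ _ => Msup_le_of_forall χ hE)
          (inv_nonneg.2 hφ.le)
    _ = ((Nat.totient d : ℝ))⁻¹ * (#((univ : Finset (DirichletCharacter ℂ d)).filter
          DirichletCharacter.IsPrimitive) * (Nat.totient d * E)) := by
        rw [Finset.sum_const, nsmul_eq_mul]
    _ ≤ ((Nat.totient d : ℝ))⁻¹ * (Nat.totient d * (Nat.totient d * E)) := by
        gcongr
        exact_mod_cast card_filter_isPrimitive_le d
    _ = Nat.totient d * E := by field_simp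
    _ ≤ d * E := by gcongr; exact_mod_cast Nat.totient_le d

/-! ### Step E: large conductors — Abel summation and the mean value theorem -/

/-- For `d ≥ 1`: `φ(d)⁻¹ ∑*_{χ mod d} M*_r(x; χ) = a_r(x; d)/d`. [folklore] -/
theorem totient_inv_mul_sum_Msup_eq {d : ℕ} (hd : 1 ≤ d) (r : ℕ) (x : ℝ) :
    ((Nat.totient d : ℝ))⁻¹ *
        ∑ χ ∈ (univ : Finset (DirichletCharacter ℂ d)).filter DirichletCharacter.IsPrimitive,
          Msup r χ x = mvTerm r x d / d := by
  have hd0 : (d : ℝ) ≠ 0 := by positivity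
  rw [mvTerm]
  field_simp

/-- **The large conductors** `D < d ≤ Q`: Abel summation and the mean value theorem give
`∑_{D < d ≤ Q} a_r(x; d)/d ≤ 110000 τ(r) log⁴(xQ) [x/(Q+1) + x^{5/6} + x^{1/2} Q + x/(D+1)
  + x^{5/6} (1 + log Q) + x^{1/2} Q]` (as `Literature.NumberTheory.Sieve.sum_Ioc_primTerm_le`).
[folklore] -/
theorem sum_Ioc_mvTerm_div_le {r : ℕ} (hr : r ≠ 0) {x : ℝ} (hx : 2 ≤ x) {Q D : ℕ} (hQ : 1 ≤ Q)
    (hD : 1 ≤ D) :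
    ∑ d ∈ Ioc D Q, mvTerm r x d / d ≤ 110000 * (σ 0 r : ℝ) * Real.log (x * Q) ^ 4 *
      (x / (Q + 1) + x ^ (5 / 6 : ℝ) + x ^ (1 / 2 : ℝ) * Q +
        (x / (D + 1) + x ^ (5 / 6 : ℝ) * (1 + Real.log Q) + x ^ (1 / 2 : ℝ) * Q)) := by
  have hx0 : 0 < x := by linarith
  set C₁ : ℝ := 110000 * (σ 0 r : ℝ) with hC₁def
  have hC₁ : 0 ≤ C₁ := by positivity
  set LQ := Real.log (x * Q) with hLQ
  set T : ℕ → ℝ := fun k => ∑ d ∈ Icc 1 k, mvTerm r x d with hT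
  have hK : 0 ≤ C₁ * LQ ^ 4 := by positivity
  have h56 : 0 ≤ x ^ (5 / 6 : ℝ) := by positivity
  have h12 : 0 ≤ x ^ (1 / 2 : ℝ) := by positivity
  have hTk : ∀ k : ℕ, 1 ≤ k → k ≤ Q →
      T k ≤ C₁ * LQ ^ 4 * (x + x ^ (5 / 6 : ℝ) * (k + 1) + x ^ (1 / 2 : ℝ) * (k * (k + 1))) := by
    intro k hk hkQ
    have hk1 : (1 : ℝ) ≤ k := by exact_mod_cast hk
    have hlogk : Real.log (x * k) ≤ LQ := by
      refine Real.log_le_log (by positivity) ?_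
      gcongr
    have hlogk0 : 0 ≤ Real.log (x * k) := Real.log_nonneg (by nlinarith)
    have h1 : x + x ^ (5 / 6 : ℝ) * k + x ^ (1 / 2 : ℝ) * (k : ℝ) ^ 2 ≤
        x + x ^ (5 / 6 : ℝ) * (k + 1) + x ^ (1 / 2 : ℝ) * (k * (k + 1)) := by
      have hk2 : (k : ℝ) ^ 2 ≤ k * (k + 1) := by nlinarith
      nlinarith [mul_le_mul_of_nonneg_left hk2 h12,
        mul_le_mul_of_nonneg_left (show (k : ℝ) ≤ k + 1 by linarith) h56]
    have h2 : Real.log (x * k) ^ 4 ≤ LQ ^ 4 := pow_le_pow_left₀ hlogk0 hlogk 4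
    calc T k ≤ C₁ * (x + x ^ (5 / 6 : ℝ) * k + x ^ (1 / 2 : ℝ) * (k : ℝ) ^ 2) *
          Real.log (x * k) ^ 4 := sum_mvTerm_le hr hk hx
      _ ≤ C₁ * (x + x ^ (5 / 6 : ℝ) * (k + 1) + x ^ (1 / 2 : ℝ) * (k * (k + 1))) * LQ ^ 4 :=
          mul_le_mul (mul_le_mul_of_nonneg_left h1 hC₁) h2 (by positivity) (by positivity)
      _ = _ := by ring
  refine (sum_Ioc_div_le_abel (mvTerm r x) (mvTerm_nonneg r x) D Q).trans ?_
  rw [mul_add (C₁ * LQ ^ 4)]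
  refine add_le_add ?_ ?_
  · have hQ0 : (0 : ℝ) < Q + 1 := by positivity
    rw [div_le_iff₀ hQ0]
    refine (hTk Q hQ le_rfl).trans (le_of_eq ?_)
    field_simp
  · calc ∑ k ∈ Ioc D Q, T k / (k * (k + 1))
        ≤ ∑ k ∈ Ioc D Q, C₁ * LQ ^ 4 *
            (x * ((k : ℝ) * (k + 1))⁻¹ + x ^ (5 / 6 : ℝ) * ((k : ℝ))⁻¹ + x ^ (1 / 2 : ℝ)) := by
          refine Finset.sum_le_sum fun k hk => ?_
          have hk1 : 1 ≤ k := by have := (Finset.mem_Ioc.1 hk).1; omega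
          have hkQ : k ≤ Q := (Finset.mem_Ioc.1 hk).2
          have hk0 : (0 : ℝ) < k := by exact_mod_cast hk1
          rw [div_le_iff₀ (by positivity)]
          refine (hTk k hk1 hkQ).trans (le_of_eq ?_)
          field_simp
      _ = C₁ * LQ ^ 4 * (x * ∑ k ∈ Ioc D Q, ((k : ℝ) * (k + 1))⁻¹ +
            x ^ (5 / 6 : ℝ) * ∑ k ∈ Ioc D Q, ((k : ℝ))⁻¹ +
            x ^ (1 / 2 : ℝ) * (Ioc D Q).card) := by
          rw [← Finset.mul_sum, Finset.sum_add_distrib, Finset.sum_add_distrib, ← Finset.mul_sum,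
            ← Finset.mul_sum, Finset.sum_const, nsmul_eq_mul, mul_comm (((Ioc D Q).card : ℕ) : ℝ)]
      _ ≤ C₁ * LQ ^ 4 * (x * ((D : ℝ) + 1)⁻¹ + x ^ (5 / 6 : ℝ) * (1 + Real.log Q) +
            x ^ (1 / 2 : ℝ) * Q) := by
          gcongr
          · exact sum_Ioc_inv_mul_succ_le D Q
          · calc ∑ k ∈ Ioc D Q, ((k : ℝ))⁻¹ ≤ ∑ k ∈ Icc 1 Q, ((k : ℝ))⁻¹ :=
                  Finset.sum_le_sum_of_subset_of_nonneg
                    (fun k hk => Finset.mem_Icc.2 ⟨by have := (Finset.mem_Ioc.1 hk).1; omega,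
                      (Finset.mem_Ioc.1 hk).2⟩) fun _ _ _ => by positivity
              _ ≤ 1 + Real.log Q := harmonic_Icc_le Q
          · rw [Nat.card_Ioc]; exact_mod_cast Nat.sub_le Q D
      _ = _ := by ring

/-! ### Divisor sums over `r` -/

/-- `τ(n)³ ≤ ∑_{ab = n} τ(a)² τ(b)²` (`τ(n) ≤ τ(a)τ(b)` for each factorisation). [folklore] -/
theorem card_divisors_pow_three_le (n : ℕ) :
    (#n.divisors : ℝ) ^ 3 ≤
      ∑ y ∈ n.divisorsAntidiagonal, (#y.1.divisors : ℝ) ^ 2 * (#y.2.divisors : ℝ) ^ 2 := by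
  have hcard : (#n.divisorsAntidiagonal : ℝ) = (#n.divisors : ℝ) := by
    rw [card_divisors_eq_sum_antidiagonal n, sum_const, nsmul_eq_mul, mul_one]
  calc (#n.divisors : ℝ) ^ 3 = (#n.divisorsAntidiagonal : ℝ) * (#n.divisors : ℝ) ^ 2 := by
        rw [hcard]; ring
    _ = ∑ _y ∈ n.divisorsAntidiagonal, (#n.divisors : ℝ) ^ 2 := by rw [sum_const, nsmul_eq_mul]
    _ ≤ _ := sum_le_sum fun y hy => by
        have hn : y.1 * y.2 = n := (Nat.mem_divisorsAntidiagonal.1 hy).1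
        have h := card_divisors_mul_le y.1 y.2
        rw [hn] at h
        have h' : (#n.divisors : ℝ) ≤ (#y.1.divisors : ℝ) * (#y.2.divisors : ℝ) := by exact_mod_cast h
        calc (#n.divisors : ℝ) ^ 2 ≤ ((#y.1.divisors : ℝ) * (#y.2.divisors : ℝ)) ^ 2 :=
              pow_le_pow_left₀ (Nat.cast_nonneg _) h' 2
          _ = _ := by ring

/-- `∑_{n ≤ K} τ(n)³/n ≤ (1 + log K)⁸` (from `τ³ ≤ τ² * τ²` and `∑ τ²/n ≤ (1 + log)⁴`). [folklore] -/
theorem sum_card_divisors_cube_div_le (K : ℕ) :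
    ∑ n ∈ Ioc 0 K, (#n.divisors : ℝ) ^ 3 / n ≤ (1 + Real.log K) ^ 8 := by
  have hτ := MoebiusExpSum.sum_sq_card_divisors_div_le K
  have hτ' : ∑ k ∈ Ioc 0 K, (#k.divisors : ℝ) ^ 2 / k ≤ (1 + Real.log K) ^ 4 := by exact_mod_cast hτ
  have h4 : 0 ≤ (1 + Real.log K) ^ 4 := by positivity
  calc ∑ n ∈ Ioc 0 K, (#n.divisors : ℝ) ^ 3 / n
      ≤ ∑ n ∈ Ioc 0 K, ∑ y ∈ n.divisorsAntidiagonal,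
          ((#y.1.divisors : ℝ) ^ 2 / y.1) * ((#y.2.divisors : ℝ) ^ 2 / y.2) := by
        refine sum_le_sum fun n hn => ?_
        have hn0 : (0 : ℝ) < n := by exact_mod_cast (mem_Ioc.1 hn).1
        rw [div_le_iff₀ hn0, sum_mul]
        refine (card_divisors_pow_three_le n).trans (le_of_eq (sum_congr rfl fun y hy => ?_))
        have hyn := (Nat.mem_divisorsAntidiagonal.1 hy).1
        have hy1 : (y.1 : ℝ) ≠ 0 := by
          have : y.1 ≠ 0 := left_ne_zero_of_mul (hyn.symm ▸ (Nat.mem_divisorsAntidiagonal.1 hy).2)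
          exact_mod_cast this
        have hy2 : (y.2 : ℝ) ≠ 0 := by
          have : y.2 ≠ 0 := right_ne_zero_of_mul (hyn.symm ▸ (Nat.mem_divisorsAntidiagonal.1 hy).2)
          exact_mod_cast this
        have hn' : (n : ℝ) = (y.1 : ℝ) * y.2 := by exact_mod_cast hyn.symm
        rw [hn']; field_simp
    _ = ∑ d ∈ Ioc 0 K, ∑ m ∈ Ioc 0 (K / d),
          ((#d.divisors : ℝ) ^ 2 / d) * ((#m.divisors : ℝ) ^ 2 / m) :=
        sum_Ioc_sum_divisorsAntidiagonal_eq
          (fun d m => ((#d.divisors : ℝ) ^ 2 / d) * ((#m.divisors : ℝ) ^ 2 / m)) K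
    _ ≤ ∑ d ∈ Ioc 0 K, ((#d.divisors : ℝ) ^ 2 / d) * (1 + Real.log K) ^ 4 := by
        refine sum_le_sum fun d _ => ?_
        rw [← mul_sum]
        refine mul_le_mul_of_nonneg_left (le_trans ?_ hτ') (by positivity)
        exact sum_le_sum_of_subset_of_nonneg (Ioc_subset_Ioc_right (Nat.div_le_self K d))
          fun _ _ _ => by positivity
    _ = (∑ d ∈ Ioc 0 K, (#d.divisors : ℝ) ^ 2 / d) * (1 + Real.log K) ^ 4 := by rw [sum_mul]
    _ ≤ (1 + Real.log K) ^ 4 * (1 + Real.log K) ^ 4 := mul_le_mul_of_nonneg_right hτ' h4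
    _ = (1 + Real.log K) ^ 8 := by ring

/-- `1/φ(m) ≤ τ(m)/m` (from `m ≤ φ(m) τ(m)`). [folklore] -/
theorem inv_totient_le {m : ℕ} (hm : 1 ≤ m) :
    ((Nat.totient m : ℝ))⁻¹ ≤ (#m.divisors : ℝ) / m := by
  have hφ : 0 < (Nat.totient m : ℝ) := by exact_mod_cast Nat.totient_pos.2 hm
  have hm0 : 0 < (m : ℝ) := by exact_mod_cast hm
  rw [inv_eq_one_div, div_le_div_iff₀ hφ hm0, one_mul]
  have h := self_le_totient_mul_card_divisors m
  calc (m : ℝ) ≤ (Nat.totient m * #m.divisors : ℕ) := by exact_mod_cast h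
    _ = (#m.divisors : ℝ) * Nat.totient m := by push_cast; ring

/-- `τ(m)/φ(m) ≤ τ(m)²/m`. [folklore] -/
theorem card_divisors_div_totient_le {m : ℕ} (hm : 1 ≤ m) :
    (#m.divisors : ℝ) / Nat.totient m ≤ (#m.divisors : ℝ) ^ 2 / m := by
  rw [div_eq_mul_inv, sq, mul_div_assoc]
  exact mul_le_mul_of_nonneg_left (inv_totient_le hm) (Nat.cast_nonneg _)

/-- `4^{ω(m)}/φ(m) ≤ τ(m)³/m`. [folklore] -/
theorem four_pow_div_totient_le {m : ℕ} (hm : 1 ≤ m) :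
    (4 : ℝ) ^ m.primeFactors.card / Nat.totient m ≤ (#m.divisors : ℝ) ^ 3 / m := by
  have h4 := four_pow_card_primeFactors_le_sigma_zero_sq (q := m) (by omega)
  rw [sigma_zero_apply] at h4
  rw [div_eq_mul_inv, pow_succ, mul_div_assoc]
  exact mul_le_mul h4 (inv_totient_le hm) (inv_nonneg.2 (Nat.cast_nonneg _)) (by positivity)

/-- `∑_{r ≤ Q} τ(r)/φ(r) ≤ (1 + log Q)⁴`. [folklore] -/
theorem sum_card_divisors_div_totient_le (Q : ℕ) :
    ∑ r ∈ Icc 1 Q, (#r.divisors : ℝ) / Nat.totient r ≤ (1 + Real.log Q) ^ 4 := by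
  have hτ := MoebiusExpSum.sum_sq_card_divisors_div_le Q
  have hτ' : ∑ k ∈ Ioc 0 Q, (#k.divisors : ℝ) ^ 2 / k ≤ (1 + Real.log Q) ^ 4 := by exact_mod_cast hτ
  rw [← Ioc_zero_eq_Icc_one]
  exact le_trans (sum_le_sum fun r hr => card_divisors_div_totient_le (mem_Ioc.1 hr).1) hτ'

/-- `∑_{r ≤ Q} 4^{ω(r)}/φ(r) ≤ (1 + log Q)⁸`. [folklore] -/
theorem sum_four_pow_div_totient_le (Q : ℕ) :
    ∑ r ∈ Icc 1 Q, (4 : ℝ) ^ r.primeFactors.card / Nat.totient r ≤ (1 + Real.log Q) ^ 8 := by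
  rw [← Ioc_zero_eq_Icc_one]
  exact le_trans (sum_le_sum fun r hr => four_pow_div_totient_le (mem_Ioc.1 hr).1)
    (sum_card_divisors_cube_div_le Q)

/-! ### Assembling the reduction under the eventual side conditions on `x` -/

set_option maxHeartbeats 1600000 in
/-- The pointwise Bombieri–Vinogradov bound for `μ` under the eventual side conditions on `x`, with
level exponent `B = A + 8`, small/large cut `D = ⌊(log x)^B⌋` and Siegel–Walfisz saving
`(log x)^{3B}` for moduli `≤ (log x)^B` (the hypothesis `hSW`, supplied by
`Literature.NumberTheory.Sieve.Polymath8a.sum_moebius_coprime_progression_le_uniform`). [folklore] -/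
theorem sum_abs_moebiusDisc_le_of_bounds {A Csw : ℝ} (hA : 1 ≤ A) (hCsw : 0 ≤ Csw)
    (hSW : ∀ x : ℝ, 2 ≤ x → ∀ k : ℕ, 1 ≤ k → (k : ℝ) ≤ Real.log x ^ (A + 8) →
      ∀ a : ZMod k, IsUnit a → ∀ r : ℕ, r ≠ 0 → ∀ t : ℝ, 1 ≤ t → t ≤ x →
        |∑ n ∈ (Icc 1 ⌊t⌋₊).filter (fun n : ℕ => (n : ZMod k) = a ∧ n.Coprime r), (μ n : ℝ)| ≤
          Csw * (4 : ℝ) ^ r.primeFactors.card * x / Real.log x ^ (3 * (A + 8)))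
    {x : ℝ} (hx : 9 ≤ x) (hL : 2 ≤ Real.log x)
    (hM : Real.log x ^ (A + 8 + 1) ≤ x ^ (1 / 6 : ℝ))
    {Q : ℕ} (hQ : 1 ≤ Q) (hQle : (Q : ℝ) ≤ x ^ (1 / 2 : ℝ) / Real.log x ^ (A + 8))
    (N : ℕ → ℕ) (hN : ∀ q, (N q : ℝ) ≤ x) (a : (q : ℕ) → ZMod q)
    (ha : ∀ q ∈ Icc 1 Q, IsUnit (a q)) :
    ∑ q ∈ Icc 1 Q, |moebiusDisc (N q) q (a q)| ≤ (Csw + 3960000) * x / Real.log x ^ A := by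
  have hx0 : 0 < x := by linarith
  have hx1 : 1 ≤ x := by linarith
  have hx2 : (2 : ℝ) ≤ x := by linarith
  -- notation
  set L := Real.log x with hLdef
  set B := A + 8 with hBdef
  set s := x ^ (1 / 2 : ℝ) with hsdef
  set u := x ^ (1 / 6 : ℝ) with hudef
  set D := ⌊L ^ B⌋₊ with hDdef
  -- positivity and power bookkeeping
  have hL0 : 0 < L := by linarith
  have hL1 : 1 ≤ L := by linarith
  have hB0 : 0 < B := by simp only [hBdef]; linarith
  have hLp : ∀ e : ℝ, 0 < L ^ e := fun e => Real.rpow_pos_of_pos hL0 e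
  have hLmono : ∀ {e₁ e₂ : ℝ}, e₁ ≤ e₂ → L ^ e₁ ≤ L ^ e₂ := fun h =>
    Real.rpow_le_rpow_of_exponent_le hL1 h
  have hLadd : ∀ e₁ e₂ : ℝ, L ^ (e₁ + e₂) = L ^ e₁ * L ^ e₂ := fun e₁ e₂ => Real.rpow_add hL0 e₁ e₂
  have hs0 : 0 < s := Real.rpow_pos_of_pos hx0 _
  have hu0 : 0 < u := Real.rpow_pos_of_pos hx0 _
  have hss : s * s = x := by rw [hsdef, ← Real.rpow_add hx0]; norm_num
  have h56 : 0 ≤ x ^ (5 / 6 : ℝ) := by positivity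
  have h56u : x ^ (5 / 6 : ℝ) * u = x := by rw [hudef, ← Real.rpow_add hx0]; norm_num
  have hus : u ≤ s := Real.rpow_le_rpow_of_exponent_le hx1 (by norm_num)
  have hL4 : L ^ (4 : ℝ) = L ^ 4 := by
    rw [show (4 : ℝ) = (4 : ℕ) by norm_num, Real.rpow_natCast]
  have hL8 : L ^ (8 : ℝ) = L ^ 8 := by
    rw [show (8 : ℝ) = (8 : ℕ) by norm_num, Real.rpow_natCast]
  have hLB1 : L ^ (B + 1) = L ^ B * L := by rw [hLadd, Real.rpow_one]
  have hLBu : L ^ B ≤ u := le_trans (by rw [hLB1]; exact le_mul_of_one_le_right (hLp B).le hL1) hM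
  have hLB1u : L ^ B * L ≤ u := hLB1 ▸ hM
  have hLB1' : 1 ≤ L ^ B := Real.one_le_rpow hL1 hB0.le
  -- decompositions of the exponents
  have hB4 : L ^ B = L ^ (A + 4) * L ^ 4 := by
    rw [← hL4, ← hLadd]; congr 1; simp only [hBdef]; ring
  have hB8 : L ^ B = L ^ A * L ^ 8 := by
    rw [← hL8, ← hLadd]
  have hA4 : L ^ (A + 4) = L ^ A * L ^ 4 := by rw [← hL4, ← hLadd]
  have h3B : L ^ (3 * (A + 8)) = L ^ B * L ^ B * L ^ B := by
    rw [← hLadd, ← hLadd]; congr 1; simp only [hBdef]; ring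
  -- facts about `Q`
  have hQ1 : (1 : ℝ) ≤ Q := by exact_mod_cast hQ
  have hQs : (Q : ℝ) ≤ s := hQle.trans (div_le_self hs0.le hLB1')
  have hlogQ : Real.log Q ≤ L / 2 := by
    refine (Real.log_le_log (by linarith) hQs).trans (le_of_eq ?_)
    rw [hsdef, Real.log_rpow hx0]; ring
  have hlogQ0 : 0 ≤ Real.log Q := Real.log_nonneg hQ1
  have h1logQ : 1 + Real.log Q ≤ L := by linarith
  -- facts about `D`
  have hDle : (D : ℝ) ≤ L ^ B := Nat.floor_le (by positivity)
  have hDlt : L ^ B < D + 1 := Nat.lt_floor_add_one _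
  have hD1 : 1 ≤ D := Nat.le_floor (by exact_mod_cast hLB1')
  -- the small-conductor unit `E r = Csw 4^{ω(r)} x / L^{3B}` and its use
  set E : ℕ → ℝ := fun r => Csw * (4 : ℝ) ^ r.primeFactors.card * x / L ^ (3 * (A + 8)) with hEdef
  have hE0 : ∀ r, 0 ≤ E r := fun r => by simp only [hEdef]; positivity
  have hEuse : ∀ r : ℕ, r ≠ 0 → ∀ d : ℕ, 1 ≤ d → d ≤ D → ∀ b : (ZMod d)ˣ, ∀ N' : ℕ, N' ≤ ⌊x⌋₊ →
      |∑ n ∈ (Icc 1 N').filter (fun n : ℕ => (n : ZMod d) = b ∧ n.Coprime r), (μ n : ℝ)| ≤ E r := by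
    intro r hr d hd hdD b N' hN'
    rcases Nat.eq_zero_or_pos N' with rfl | hN'0
    · simp only [show Icc 1 0 = (∅ : Finset ℕ) by rfl, Finset.filter_empty, Finset.sum_empty,
        abs_zero]
      exact hE0 r
    · have hdL : (d : ℝ) ≤ Real.log x ^ (A + 8) := by
        have : (d : ℝ) ≤ D := by exact_mod_cast hdD
        exact this.trans hDle
      have h1N : (1 : ℝ) ≤ N' := by exact_mod_cast hN'0
      have hNx : (N' : ℝ) ≤ x := le_trans (by exact_mod_cast hN') (Nat.floor_le hx0.le)
      have h := hSW x hx2 d hd hdL (b : ZMod d) b.isUnit r hr N' h1N hNx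
      rw [Nat.floor_natCast] at h
      exact h
  -- Steps A–C
  set f : ℕ → ℕ → ℝ := fun r d => if d = 1 then 0 else ((Nat.totient d : ℝ))⁻¹ *
    ∑ χ ∈ (univ : Finset (DirichletCharacter ℂ d)).filter DirichletCharacter.IsPrimitive,
      Msup r χ x with hfdef
  have hf0 : ∀ r d, 0 ≤ f r d := by
    intro r d; simp only [hfdef]; split_ifs
    · exact le_rfl
    · exact mul_nonneg (inv_nonneg.2 (Nat.cast_nonneg _))
        (Finset.sum_nonneg fun χ _ => Msup_nonneg r χ x)
  have hAC : ∑ q ∈ Icc 1 Q, |moebiusDisc (N q) q (a q)| ≤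
      ∑ r ∈ Icc 1 Q, ((Nat.totient r : ℝ))⁻¹ * ∑ d ∈ Icc 1 (Q / r), f r d := by
    refine le_trans (Finset.sum_le_sum fun q hq => ?_) (sum_totient_inv_mul_sum_primIndex_le Q x)
    haveI : NeZero q := ⟨by have := (mem_Icc.1 hq).1; omega⟩
    exact abs_moebiusDisc_le_sum_primIndex q (ha q hq) (hN q)
  -- the bound for one `r`
  have hSr : ∀ r ∈ Icc 1 Q, ∑ d ∈ Icc 1 (Q / r), f r d ≤
      Csw * ((4 : ℝ) ^ r.primeFactors.card * (x / L ^ B)) +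
        3960000 * ((#r.divisors : ℝ) * (x / L ^ (A + 4))) := by
    intro r hr
    have hr1 : 1 ≤ r := (mem_Icc.1 hr).1
    have hrQ : r ≤ Q := (mem_Icc.1 hr).2
    have hr0 : r ≠ 0 := by omega
    set Qr := Q / r with hQrdef
    have hQr1 : 1 ≤ Qr := (Nat.le_div_iff_mul_le (by omega)).2 (by simpa using hrQ)
    have hQrQ : Qr ≤ Q := Nat.div_le_self Q r
    rw [← Finset.sum_filter_add_sum_filter_not (Icc 1 Qr) (fun d => d ≤ D)]
    refine add_le_add ?_ ?_
    · -- small conductors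
      have hsmall : ∀ d ∈ (Icc 1 Qr).filter (fun d => d ≤ D), f r d ≤ D * E r := by
        intro d hd
        rw [Finset.mem_filter, Finset.mem_Icc] at hd
        simp only [hfdef]
        split_ifs with h1
        · exact mul_nonneg (Nat.cast_nonneg _) (hE0 r)
        · calc _ ≤ (d : ℝ) * E r :=
                totient_inv_mul_sum_Msup_le hd.1.1 (hE0 r) (hEuse r hr0 d hd.1.1 hd.2)
            _ ≤ D * E r := by gcongr; exact_mod_cast hd.2
      calc ∑ d ∈ (Icc 1 Qr).filter (fun d => d ≤ D), f r d
          ≤ ∑ _d ∈ (Icc 1 Qr).filter (fun d => d ≤ D), (D : ℝ) * E r := Finset.sum_le_sum hsmall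
        _ = #((Icc 1 Qr).filter (fun d => d ≤ D)) * ((D : ℝ) * E r) := by
            rw [Finset.sum_const, nsmul_eq_mul]
        _ ≤ D * ((D : ℝ) * E r) := by
            gcongr
            have hsub : (Icc 1 Qr).filter (fun d => d ≤ D) ⊆ Icc 1 D := fun d hd => by
              rw [Finset.mem_filter, Finset.mem_Icc] at hd
              exact Finset.mem_Icc.2 ⟨hd.1.1, hd.2⟩
            have hc := Finset.card_le_card hsub
            rw [Nat.card_Icc] at hc
            omega
        _ ≤ L ^ B * (L ^ B * E r) := by gcongr
        _ = Csw * ((4 : ℝ) ^ r.primeFactors.card * (x / L ^ B)) := by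
            simp only [hEdef]; rw [h3B]; field_simp
    · -- large conductors
      have hset : (Icc 1 Qr).filter (fun d => ¬ d ≤ D) = Ioc D Qr := by
        ext d; simp only [Finset.mem_filter, Finset.mem_Icc, Finset.mem_Ioc]; omega
      rw [hset]
      have hτ0 : 0 ≤ (#r.divisors : ℝ) * (x / L ^ (A + 4)) := by positivity
      rcases le_or_gt Qr D with hle | hlt
      · rw [Finset.Ioc_eq_empty (by omega), Finset.sum_empty]; positivity
      · have hfe : ∀ d ∈ Ioc D Qr, f r d = mvTerm r x d / d := by
          intro d hd
          have hd1 : 1 ≤ d := by have := (Finset.mem_Ioc.1 hd).1; omega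
          simp only [hfdef]
          rw [if_neg (by have := (Finset.mem_Ioc.1 hd).1; omega), totient_inv_mul_sum_Msup_eq hd1]
        rw [Finset.sum_congr rfl hfe]
        refine (sum_Ioc_mvTerm_div_le hr0 hx2 hQr1 hD1).trans ?_
        -- the bracket is `≤ 6 x / L^B` and `log(x Qr)^4 ≤ 6 L^4`
        have hQr1' : (1 : ℝ) ≤ Qr := by exact_mod_cast hQr1
        have hQrQ' : (Qr : ℝ) ≤ Q := by exact_mod_cast hQrQ
        have hQrs : (Qr : ℝ) ≤ s := hQrQ'.trans hQs
        have hQrle : (Qr : ℝ) ≤ s / L ^ B := hQrQ'.trans hQle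
        have hQrlt : L ^ B < Qr + 1 := by
          have : (D : ℝ) + 1 ≤ Qr := by exact_mod_cast hlt
          linarith
        have hlogQr : Real.log Qr ≤ L / 2 := by
          refine (Real.log_le_log (by linarith) hQrs).trans (le_of_eq ?_)
          rw [hsdef, Real.log_rpow hx0]; ring
        have hlogQr0 : 0 ≤ Real.log Qr := Real.log_nonneg hQr1'
        have hLQ : Real.log (x * Qr) ≤ 3 / 2 * L := by
          rw [Real.log_mul hx0.ne' (by positivity)]; linarith
        have hLQ0 : 0 ≤ Real.log (x * Qr) := Real.log_nonneg (by nlinarith)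
        have hLQ4 : Real.log (x * Qr) ^ 4 ≤ 6 * L ^ 4 := by
          calc Real.log (x * Qr) ^ 4 ≤ (3 / 2 * L) ^ 4 := pow_le_pow_left₀ hLQ0 hLQ 4
            _ = 81 / 16 * L ^ 4 := by ring
            _ ≤ 6 * L ^ 4 := by gcongr; norm_num
        have hxB : ∀ t : ℝ, t * L ^ B ≤ x → t ≤ x / L ^ B := fun t ht => (le_div_iff₀ (hLp B)).2 ht
        have t1 : x / (Qr + 1) ≤ x / L ^ B := div_le_div_of_nonneg_left hx0.le (hLp B) hQrlt.le
        have t2 : x ^ (5 / 6 : ℝ) ≤ x / L ^ B := hxB _ (by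
          calc x ^ (5 / 6 : ℝ) * L ^ B ≤ x ^ (5 / 6 : ℝ) * u := by gcongr
            _ = x := h56u)
        have t3 : s * Qr ≤ x / L ^ B := hxB _ (by
          calc s * Qr * L ^ B = s * (Qr * L ^ B) := by ring
            _ ≤ s * s := by gcongr; exact (le_div_iff₀ (hLp B)).1 hQrle
            _ = x := hss)
        have t4 : x / (D + 1) ≤ x / L ^ B := div_le_div_of_nonneg_left hx0.le (hLp B) hDlt.le
        have t5 : x ^ (5 / 6 : ℝ) * (1 + Real.log Qr) ≤ x / L ^ B := hxB _ (by
          calc x ^ (5 / 6 : ℝ) * (1 + Real.log Qr) * L ^ B ≤ x ^ (5 / 6 : ℝ) * L * L ^ B := by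
                gcongr; linarith
            _ = x ^ (5 / 6 : ℝ) * (L ^ B * L) := by ring
            _ ≤ x ^ (5 / 6 : ℝ) * u := by gcongr
            _ = x := h56u)
        have hbr : x / (Qr + 1) + x ^ (5 / 6 : ℝ) + s * Qr +
            (x / (D + 1) + x ^ (5 / 6 : ℝ) * (1 + Real.log Qr) + s * Qr) ≤ 6 * (x / L ^ B) := by
          linarith only [t1, t2, t3, t4, t5]
        have hbr0 : 0 ≤ x / (Qr + 1) + x ^ (5 / 6 : ℝ) + s * Qr +
            (x / (D + 1) + x ^ (5 / 6 : ℝ) * (1 + Real.log Qr) + s * Qr) := by positivity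
        have hxLB : L ^ 4 * (x / L ^ B) = x / L ^ (A + 4) := by
          have h4 : (L ^ 4 : ℝ) ≠ 0 := by positivity
          rw [hB4, div_mul_eq_div_div, mul_div_assoc', mul_div_cancel_left₀ _ h4]
        have hσ : (0 : ℝ) ≤ σ 0 r := Nat.cast_nonneg _
        calc 110000 * (σ 0 r : ℝ) * Real.log (x * Qr) ^ 4 *
              (x / (Qr + 1) + x ^ (5 / 6 : ℝ) + s * Qr +
                (x / (D + 1) + x ^ (5 / 6 : ℝ) * (1 + Real.log Qr) + s * Qr))
            ≤ 110000 * (σ 0 r : ℝ) * (6 * L ^ 4) * (6 * (x / L ^ B)) :=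
              mul_le_mul (mul_le_mul_of_nonneg_left hLQ4 (by positivity)) hbr hbr0 (by positivity)
          _ = 3960000 * ((σ 0 r : ℝ) * (L ^ 4 * (x / L ^ B))) := by ring
          _ = 3960000 * ((#r.divisors : ℝ) * (x / L ^ (A + 4))) := by rw [hxLB, sigma_zero_apply]
  -- summing over `r`
  have hsum4 := sum_four_pow_div_totient_le Q
  have hsumτ := sum_card_divisors_div_totient_le Q
  have hlog8 : (1 + Real.log Q) ^ 8 ≤ L ^ 8 := pow_le_pow_left₀ (by linarith) h1logQ 8
  have hlog4 : (1 + Real.log Q) ^ 4 ≤ L ^ 4 := pow_le_pow_left₀ (by linarith) h1logQ 4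
  have hxB0 : 0 ≤ x / L ^ B := by positivity
  have hxA40 : 0 ≤ x / L ^ (A + 4) := by positivity
  calc ∑ q ∈ Icc 1 Q, |moebiusDisc (N q) q (a q)|
      ≤ ∑ r ∈ Icc 1 Q, ((Nat.totient r : ℝ))⁻¹ * ∑ d ∈ Icc 1 (Q / r), f r d := hAC
    _ ≤ ∑ r ∈ Icc 1 Q, ((Nat.totient r : ℝ))⁻¹ * (Csw * ((4 : ℝ) ^ r.primeFactors.card * (x / L ^ B)) +
        3960000 * ((#r.divisors : ℝ) * (x / L ^ (A + 4)))) :=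
        Finset.sum_le_sum fun r hr => mul_le_mul_of_nonneg_left (hSr r hr)
          (inv_nonneg.2 (Nat.cast_nonneg _))
    _ = Csw * (x / L ^ B) * ∑ r ∈ Icc 1 Q, (4 : ℝ) ^ r.primeFactors.card / Nat.totient r +
        3960000 * (x / L ^ (A + 4)) * ∑ r ∈ Icc 1 Q, (#r.divisors : ℝ) / Nat.totient r := by
        rw [Finset.mul_sum, Finset.mul_sum, ← Finset.sum_add_distrib]
        refine Finset.sum_congr rfl fun r _ => ?_
        rw [div_eq_mul_inv, div_eq_mul_inv _ ((Nat.totient r : ℝ))]; ring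
    _ ≤ Csw * (x / L ^ B) * L ^ 8 + 3960000 * (x / L ^ (A + 4)) * L ^ 4 := by
        gcongr
        · exact hsum4.trans hlog8
        · exact hsumτ.trans hlog4
    _ = (Csw + 3960000) * x / L ^ A := by
        rw [hB8, hA4]
        field_simp

/-! ### The residue selector used by the Liouville transfer -/

/-- The residue selector `a s̄` for a square `s` coprime to `q` (junk `1` otherwise, so that the
value is always a unit). [folklore] -/
noncomputable def sqResidue (q : ℕ) (a : ZMod q) (s : ℕ) : ZMod q :=
  if s.Coprime q then a * ((s : ZMod q))⁻¹ else 1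

/-- `sqResidue q a s` is a unit whenever `a` is. [folklore] -/
theorem isUnit_sqResidue {q : ℕ} {a : ZMod q} (ha : IsUnit a) (s : ℕ) : IsUnit (sqResidue q a s) := by
  unfold sqResidue
  split_ifs with h
  · have hs : IsUnit ((s : ZMod q)) := (ZMod.isUnit_iff_coprime s q).2 h
    have hs' : IsUnit ((s : ZMod q))⁻¹ := by
      obtain ⟨u, hu⟩ := hs
      rw [← hu, ZMod.inv_coe_unit]; exact (u⁻¹).isUnit
    exact ha.mul hs'
  · exact isUnit_one

/-- `(log x)^r ≤ x^s` eventually, for `s > 0` (a copy of the tree's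
`Literature.NumberTheory.Sieve.eventually_log_rpow_le_rpow`, restated to keep the namespace
self-contained). [folklore] -/
theorem eventually_log_rpow_le_rpow' (r : ℝ) {s : ℝ} (hs : 0 < s) :
    ∀ᶠ x : ℝ in Filter.atTop, Real.log x ^ r ≤ x ^ s :=
  eventually_log_rpow_le_rpow r hs

end BVMoebius

open Finset BVMoebius in
open scoped ArithmeticFunction.Moebius in
/-- **The Bombieri–Vinogradov theorem for the Möbius function** (the case `f = μ ∈ 𝓕(1, 1)`,
`D = 1` of Fouvry–Tenenbaum, Trans. Amer. Math. Soc. 375 (2022), Theorem 1.8; classical, e.g.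
a special case of Iwaniec–Kowalski Theorem 17.4 / Wolke, Math. Ann. 202 (1973), Satz 1): for every
`A > 0` there are `B > 0`, `C ≥ 0`, `x₀` such that for all `x ≥ x₀`, all `Q ≤ x^{1/2}(log x)^{−B}`,
all integer cut-offs `N_q ≤ x` and all reduced residues `a_q (mod q)`,
`∑_{q ≤ Q} |∑_{n ≤ N_q, n ≡ a_q (q)} μ(n) − φ(q)⁻¹ ∑_{n ≤ N_q, (n,q)=1} μ(n)| ≤ C x (log x)^{−A}`.
PROVED by Vaughan's method (as the tree's `bombieri_vinogradov_holds` for `Λ`): orthogonality,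
reduction to primitive characters (which produces the coprimality condition `(n, q/d) = 1`,
`Literature.NumberTheory.Sieve.BVMoebius.changeLevel_apply_natCast`), the Siegel–Walfisz theorem
for `μ` with a coprimality condition for conductors `≤ (log x)^B`
(`Literature.NumberTheory.Sieve.Polymath8a.sum_moebius_coprime_progression_le_uniform` and
`Literature.NumberTheory.LFunctions.SiegelWalfiszMoebius_holds`), and the mean value theorem
`Literature.NumberTheory.Sieve.moebius_character_meanValue` with Abel summation for the large
conductors; `B = max(A, 1) + 8`. [cite: FouvryTenenbaum2021, Theorem 1.8 (f = μ, D = 1)] -/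
theorem bombieriVinogradov_moebius (A : ℝ) (hA : 0 < A) :
    ∃ B C x₀ : ℝ, 0 < B ∧ 0 ≤ C ∧ ∀ x : ℝ, x₀ ≤ x →
      ∀ Q : ℕ, (Q : ℝ) ≤ x ^ (1 / 2 : ℝ) / Real.log x ^ B →
      ∀ N : ℕ → ℕ, (∀ q, (N q : ℝ) ≤ x) →
      ∀ a : (q : ℕ) → ZMod q, (∀ q ∈ Icc 1 Q, IsUnit (a q)) →
        ∑ q ∈ Icc 1 Q, |moebiusDisc (N q) q (a q)| ≤ C * x / Real.log x ^ A := by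
  set A' := max A 1 with hA'def
  have hA' : 1 ≤ A' := le_max_right _ _
  have hAA' : A ≤ A' := le_max_left _ _
  obtain ⟨Csw, hCsw0, hSW⟩ := Polymath8a.sum_moebius_coprime_progression_le_uniform
    LFunctions.SiegelWalfiszMoebius_holds (A := A' + 8) (by positivity) (B := 3 * (A' + 8))
    (by positivity)
  have hev : ∀ᶠ x : ℝ in Filter.atTop, 9 ≤ x ∧ 2 ≤ Real.log x ∧
      Real.log x ^ (A' + 8 + 1) ≤ x ^ (1 / 6 : ℝ) := by
    filter_upwards [Filter.eventually_ge_atTop (9 : ℝ),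
      Real.tendsto_log_atTop.eventually_ge_atTop (2 : ℝ),
      eventually_log_rpow_le_rpow' (A' + 8 + 1) (by norm_num : (0 : ℝ) < 1 / 6)] with x h1 h2 h3
    exact ⟨h1, h2, h3⟩
  obtain ⟨x₀, hx₀⟩ := Filter.eventually_atTop.1 hev
  refine ⟨A' + 8, Csw + 3960000, x₀, by positivity, by positivity, ?_⟩
  intro x hx Q hQle N hN a ha
  obtain ⟨hx9, hL2, hM⟩ := hx₀ x hx
  have hx0 : 0 < x := by linarith
  have hL1 : 1 ≤ Real.log x := by linarith
  have hLA : 0 < Real.log x ^ A := Real.rpow_pos_of_pos (by linarith) _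
  rcases Nat.eq_zero_or_pos Q with rfl | hQ
  · rw [show Icc 1 0 = (∅ : Finset ℕ) by rfl, Finset.sum_empty]
    positivity
  · refine (sum_abs_moebiusDisc_le_of_bounds hA' hCsw0 hSW hx9 hL2 hM hQ hQle N hN a ha).trans ?_
    rw [mul_div_assoc, mul_div_assoc]
    refine mul_le_mul_of_nonneg_left ?_ (by positivity)
    exact div_le_div_of_nonneg_left hx0.le hLA (Real.rpow_le_rpow_of_exponent_le hL1 hAA')

end Literature.NumberTheory.Sieve
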